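import Summits.QuantumFields.YangMills.Theorems.DressedRitz.Negative.RawVacuumLoadBearing
import HarnessLib

/-!
# Crux `DressedRitz` (stmt-QuantumFields-20205), line «polyakovlift» r2 — the `∀`-basis ROTATION HAZARD of clause (o2) inside a
# degenerate one-site level: identity, contrapositive hazard, and ★ its VANISHING on symmetry doublets (Schur for a 2 × 2 invariant form)

Standing crux disprover `ym-cdisprove-20205-1` g1 (refuter), supporting item stmt-QuantumFields-20205 (no verdict change).  The registered S-STAT
stub quantifies clause (o2) `|⟨u_i,u_l⟩| ≤ Cλ√n_i√n_l` over EVERY lift basis, hence over every rotation `(g_a,g_b) ↦ (c g_a + s g_b, −s g_a + c g_b)`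
inside an exactly degenerate one-site level at `B₁ = 2/λ³`; the lift `g ↦ ins φ (flowLiftAt 0 t g)` is linear, so the lifted pair rotates the same
way.  This file settles what that costs, by pure bilinear algebra over physical vectors `u, v` of the fine theory:

* §1 `l2_rotation_self`, `l2_rotation_pair` — `‖cu+sv‖² = c²n_u + 2cs⟨u,v⟩ + s²n_v`, `⟨cu+sv, −su+cv⟩ = cs(n_v − n_u) + (c² − s²)⟨u,v⟩`;
* §2 `o2_rotation_hazard` — HAZARD (contrapositive): an orthogonal lifted pair whose norms differ by more than the budget after rotation,
  `Cλ√n_θ√n'_θ < |cs|·|n_v − n_u|`, violates (o2) at the rotated (admissible) basis; so `∀`-basis S-STAT forces `|n_a − n_b| = O(λ)` across every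
  exactly degenerate one-site level;
* §3 ★ `schur_doublet` — the hazard is VOID on symmetry doublets: if the Gram data of `(u, v)` are invariant under ONE non-trivial rotation
  (`c² + s² = 1`, `s ≠ 0`: `‖cu+sv‖² = ‖u‖²` and `⟨cu+sv, −su+cv⟩ = ⟨u,v⟩`) then `⟨u,v⟩ = 0` and `‖u‖ = ‖v‖` (`schur_doublet_real` is the statement
  about five real numbers), whence ★ `l2_rotation_eq_zero_of_invariant`: EVERY rotation of the pair is orthogonal — (o2) holds with constant `0` for
  all bases of that level.  For the lifted members of a 2-dimensional irreducible `S₃`-multiplet (axis permutations; a 3-cycle acts in any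
  one-site-orthonormal basis of the doublet by a rotation of order 3, `s = ±√3/2 ≠ 0`) the two invariance hypotheses are exactly what the tree's
  equivariance (`…SlabFlowLiftAxisPermutation`) and vacuum invariance (`…AxisPermutation`, `PolyakovLift.l2_ins_flowLiftAt_comp_configPerm`) deliver, so
  the residual `∀`-basis content of (o2) sits ONLY at accidental crossings of two levels in the same `S₃`-isotypic class (complementing
  `PolyakovLift.liftFamily_o2_of_symmetrySeparated`, the inter-isotypic zeros).  The same real-number lemma applies verbatim to the coupling form
  `⟨·, K_β ·⟩` of clause (o6).

HONEST FRAMING: bilinear algebra at fixed lattice on the CONDITIONAL femto rung R2b1; no estimate is proved; nothing here bears on infinite volume, the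
continuum limit or the Clay mass gap.  [folklore]
-/

set_option autoImplicit false

noncomputable section

open MeasureTheory Filter Topology Real
open Literature.MathematicalPhysics.QuantumFieldTheory
open Literature.MathematicalPhysics.QuantumLattice

namespace Summit.QuantumFields.YangMills.Theorems.FemtoTransferGap.PolyakovLift.Negative

open Summit.QuantumFields.YangMills.Theorems.FemtoTransferGap
open Summit.QuantumFields.YangMills.Theorems.FemtoTransferGap.PolyakovLift

/-! ## §1 Rotation identities -/

section Rotation

variable {L : ℕ} [NeZero L] {u v : GaugeConfig 3 L SU2 → ℝ}

/-- `‖cu + sv‖² = c²‖u‖² + 2cs⟨u,v⟩ + s²‖v‖²` for physical `u, v`. [folklore] -/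
theorem l2_rotation_self (hu : IsPhys u) (hv : IsPhys v) (c s : ℝ) :
    l2 (c • u + s • v) (c • u + s • v) = c ^ 2 * l2 u u + 2 * c * s * l2 u v + s ^ 2 * l2 v v := by
  have h1 : IsPhys (c • u) := hu.smul c
  have h2 : IsPhys (s • v) := hv.smul s
  rw [l2_add_right (h1.add h2) h1 h2, l2_add_left h1 h2 h1, l2_add_left h1 h2 h2]
  simp only [l2_smul_left, l2_smul_right'']
  rw [l2_comm v u]
  ring

/-- `⟨cu + sv, −su + cv⟩ = cs(‖v‖² − ‖u‖²) + (c² − s²)⟨u,v⟩` for physical `u, v`. [folklore] -/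
theorem l2_rotation_pair (hu : IsPhys u) (hv : IsPhys v) (c s : ℝ) :
    l2 (c • u + s • v) ((-s) • u + c • v) = c * s * (l2 v v - l2 u u) + (c ^ 2 - s ^ 2) * l2 u v := by
  have h1 : IsPhys (c • u) := hu.smul c
  have h2 : IsPhys (s • v) := hv.smul s
  have h3 : IsPhys ((-s) • u) := hu.smul (-s)
  have h4 : IsPhys (c • v) := hv.smul c
  rw [l2_add_right (h1.add h2) h3 h4, l2_add_left h1 h2 h3, l2_add_left h1 h2 h4]
  simp only [l2_smul_left, l2_smul_right'']
  rw [l2_comm v u]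
  ring

/-- An orthogonal pair with EQUAL norms stays orthogonal under every rotation. [folklore] -/
theorem l2_rotation_pair_eq_zero (hu : IsPhys u) (hv : IsPhys v) (horth : l2 u v = 0) (hn : l2 u u = l2 v v) (c s : ℝ) :
    l2 (c • u + s • v) ((-s) • u + c • v) = 0 := by
  rw [l2_rotation_pair hu hv, horth, hn]
  ring

/-- For an orthogonal pair the rotated Gram entry is `|cs|·|‖v‖² − ‖u‖²|`. [folklore] -/
theorem abs_l2_rotation_pair (hu : IsPhys u) (hv : IsPhys v) (horth : l2 u v = 0) (c s : ℝ) :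
    |l2 (c • u + s • v) ((-s) • u + c • v)| = |c * s| * |l2 v v - l2 u u| := by
  rw [l2_rotation_pair hu hv, horth, mul_zero, add_zero, abs_mul]

end Rotation

/-! ## §2 The hazard (contrapositive form) -/

/-- ★ **(o2) rotation hazard.**  Two orthogonal lifted members of one exactly degenerate one-site level whose norms differ by more than the
(o2) budget after rotation violate clause (o2) at the rotated basis (an admissible lift basis): `∀`-basis S-STAT forces `|n_a − n_b| = O(λ)` on
every exactly degenerate one-site level at the lift coupling.  (`lam` stands for `luscherLambda β L`.) [folklore] -/
theorem o2_rotation_hazard {L : ℕ} [NeZero L] {u v : GaugeConfig 3 L SU2 → ℝ} (hu : IsPhys u) (hv : IsPhys v) (horth : l2 u v = 0)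
    {C lam : ℝ} (c s : ℝ)
    (hgap : C * lam * (Real.sqrt (l2 (c • u + s • v) (c • u + s • v)) *
        Real.sqrt (l2 ((-s) • u + c • v) ((-s) • u + c • v))) < |c * s| * |l2 v v - l2 u u|) :
    ¬ (|l2 (c • u + s • v) ((-s) • u + c • v)| ≤
        C * lam * (Real.sqrt (l2 (c • u + s • v) (c • u + s • v)) *
          Real.sqrt (l2 ((-s) • u + c • v) ((-s) • u + c • v)))) := by
  rw [abs_l2_rotation_pair hu hv horth]
  exact not_le.mpr hgap

/-! ## §3 ★ The hazard is void on symmetry doublets: Schur for an invariant symmetric 2 × 2 form -/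

/-- ★ **Schur for a doublet, real-number form.**  A symmetric `2 × 2` form `(n_u, X; X, n_v)` invariant under one non-trivial rotation
`(c, s)` (`c² + s² = 1`, `s ≠ 0`) is scalar: `X = 0` and `n_u = n_v`.  (Invariance equations: the rotated diagonal entry equals `n_u`, the rotated
off-diagonal entry equals `X`.) [folklore] -/
theorem schur_doublet_real {nu nv X c s : ℝ} (hcs : c ^ 2 + s ^ 2 = 1) (hs : s ≠ 0)
    (h11 : c ^ 2 * nu + 2 * c * s * X + s ^ 2 * nv = nu)
    (h12 : c * s * (nv - nu) + (c ^ 2 - s ^ 2) * X = X) : X = 0 ∧ nu = nv := by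
  have e1 : s ^ 2 * (nv - nu) + 2 * c * s * X = 0 := by linear_combination h11 - nu * hcs
  have e2 : c * s * (nv - nu) - 2 * s ^ 2 * X = 0 := by linear_combination h12 - X * hcs
  have e3 : s * (nv - nu) = 0 := by linear_combination s * e1 + c * e2 - s * (nv - nu) * hcs
  have hΔ : nv - nu = 0 := (mul_eq_zero.mp e3).resolve_left hs
  have e4 : s ^ 2 * X = 0 := by linear_combination (-1 / 2 : ℝ) * e2 + (c * s / 2) * hΔ
  have hX : X = 0 := (mul_eq_zero.mp e4).resolve_left (pow_ne_zero 2 hs)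
  exact ⟨hX, by linarith⟩

/-- ★ **Schur for a lifted doublet.**  If the Gram data of two physical vectors are invariant under one non-trivial rotation — `‖cu+sv‖² = ‖u‖²`
and `⟨cu+sv, −su+cv⟩ = ⟨u,v⟩` with `c² + s² = 1`, `s ≠ 0` (for the lifts of a one-site-orthonormal basis of an irreducible `S₃`-doublet this is
equivariance of the lift under a 3-cycle plus invariance of the raw vacuum) — then `⟨u,v⟩ = 0` and `‖u‖² = ‖v‖²`. [folklore] -/
theorem schur_doublet {L : ℕ} [NeZero L] {u v : GaugeConfig 3 L SU2 → ℝ} (hu : IsPhys u) (hv : IsPhys v) {c s : ℝ}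
    (hcs : c ^ 2 + s ^ 2 = 1) (hs : s ≠ 0)
    (h11 : l2 (c • u + s • v) (c • u + s • v) = l2 u u)
    (h12 : l2 (c • u + s • v) ((-s) • u + c • v) = l2 u v) :
    l2 u v = 0 ∧ l2 u u = l2 v v := by
  rw [l2_rotation_self hu hv] at h11
  rw [l2_rotation_pair hu hv] at h12
  exact schur_doublet_real hcs hs h11 h12

/-- ★★ **The `∀`-basis rotation hazard of (o2) is VOID on symmetry doublets**: under the hypotheses of `schur_doublet`, EVERY rotation
`(c', s')` of the pair is orthogonal — clause (o2) holds with constant `0` for all bases of that level. [folklore] -/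
theorem l2_rotation_eq_zero_of_invariant {L : ℕ} [NeZero L] {u v : GaugeConfig 3 L SU2 → ℝ} (hu : IsPhys u) (hv : IsPhys v)
    {c s : ℝ} (hcs : c ^ 2 + s ^ 2 = 1) (hs : s ≠ 0)
    (h11 : l2 (c • u + s • v) (c • u + s • v) = l2 u u)
    (h12 : l2 (c • u + s • v) ((-s) • u + c • v) = l2 u v) (c' s' : ℝ) :
    l2 (c' • u + s' • v) ((-s') • u + c' • v) = 0 := by
  obtain ⟨hX, hn⟩ := schur_doublet hu hv hcs hs h11 h12
  exact l2_rotation_pair_eq_zero hu hv hX hn c' s'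

/-- … and all rotated members have the SAME norm `‖u‖²` when `c'² + s'² = 1` (so the diagonal data (o4), (o5) of the level are basis-independent
as far as the norms go). [folklore] -/
theorem l2_rotation_self_eq_of_invariant {L : ℕ} [NeZero L] {u v : GaugeConfig 3 L SU2 → ℝ} (hu : IsPhys u) (hv : IsPhys v)
    {c s : ℝ} (hcs : c ^ 2 + s ^ 2 = 1) (hs : s ≠ 0)
    (h11 : l2 (c • u + s • v) (c • u + s • v) = l2 u u)
    (h12 : l2 (c • u + s • v) ((-s) • u + c • v) = l2 u v) {c' s' : ℝ} (hcs' : c' ^ 2 + s' ^ 2 = 1) :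
    l2 (c' • u + s' • v) (c' • u + s' • v) = l2 u u := by
  obtain ⟨hX, hn⟩ := schur_doublet hu hv hcs hs h11 h12
  rw [l2_rotation_self hu hv, hX, ← hn]
  linear_combination l2 u u * hcs'

end Summit.QuantumFields.YangMills.Theorems.FemtoTransferGap.PolyakovLift.Negative

end
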